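import Summits.BirchSwinnertonDyer.BirchSwinnertonDyer.Theorems.RamifiedHeegnerPairLeafRankZeroUpperAtThreeShimuraInertPairingCore
import Summits.BirchSwinnertonDyer.BirchSwinnertonDyer.Theorems.RamifiedHeegnerPairLeafPartnerRT
import HarnessLib

/-!
# Route `RamifiedHeegnerPair`, crux U₀ `LeafRankZeroUpperAtThree` (stmt-BirchSwinnertonDyer-26024), line `partnerdescent0` (mirror) —
# the PARTNER PAIRING CORE AT RANK ZERO: U₀ at a leaf curve from ONE field datum, the Ribet–Takahashi package of the `3`-GOOD twist
# partner (exact at `3` by (G3)) and a real display sourced from the partner's Shimura parametrisation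

HONEST FRAMING. Theorems only; helper file (`--supports stmt-BirchSwinnertonDyer-26024 --as helper`); no definition, no named
fact, no `sorry`; nothing booked, no item closed; CONDITIONAL on every displayed input; BSD is proved for no curve. Lead prover
bsd-line-rhp-p2 g55, 2026-08-30. Rank-zero mirror of `…Theorems.RamifiedHeegnerPairLeafPartnerPairingCore.lean` (same seat, same day).

WHAT. `leafRankZeroUpper_three_of_partnerDatum_at_pairing` = this lineage's U₀ part 6
`LeafShimuraInert.leafRankZeroUpper_three_of_shimuraInertDatum_at_pairing` (leaf `W`, `r_an = 0`, datum with `3 ∤ c`, even inert set `S`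
of multiplicative primes holding every Tamagawa-`3` carrier, SHAPE, très-ramifié clause off `S`, a field with `S` inert and every other bad
prime split, `d_K` odd, the twist with a SIMPLE zero, partner lower for the rank-one twist) with the TWO changes of the rank-one partner
core: the Ribet–Takahashi package runs on the `3`-good PARTNER `V` (globally minimal, `3 ∤ N_V`, `V[3]` irreducible, multiplicative on `S`
with the same `ord_ℓ Δ_min`), exact at `3` by (G3) (`LeafPartnerRT.padicValNat_delta_empty_eq_of_cokernelUnits`), and the display is asked
AT `V`'s class-minimal Shimura datum in REAL form with `E`'s Néron lattice and `V`'s optimal `(deg(D₀), c(D₀))`: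
`degS·L′(E/K,1) = (2covol(Λ_E)·deg(D₀)/(c(D₀)²(w/2)²√|d_K|))·ĥ_K(P)`. The rank-zero bookkeeping
`exists_shaAn_padicVal_eq_of_gzIdentity_rankZero_ratFactorVal` (bsd-print-x6: a RATIONAL factor `ρ` of any valuation) is fed with
`ρ := deg(D₀)·c(Dt)²/(c(D₀)²·degS)`, `ord₃ ρ = Σ_S ord₃ ord_ℓ Δ_min(W)`. CONCLUSION: `Typed.MissingUpperBoundAt W 3`.
-- adapted from Summits/BirchSwinnertonDyer/BirchSwinnertonDyer/Theorems/RamifiedHeegnerPairLeafRankZeroUpperAtThreeShimuraInertPairingCore.lean (package on the partner, (G3) for (DEG), real display)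

References: [cite: CaiShuTian2014, Thm. 1.1 and Thm. 1.5] [cite: PastenShimura2024, Prop. 6.13, Lemmas 6.8, 6.14, §6.9 (pp. 22–25, 33)]
[cite: PapikianRabinoff2016, Thm. 37 and the Remark following it] [cite: RibetTakahashi1997, Thm. 1] [cite: AbbesUllmo1996, Thm. A]
[cite: JetchevSkinnerWan2017, §7.4.1–7.4.2, Thm. 4.4.1] [cite: GrossZagier1986, V.§2] [cite: Miller2011LMS, Def. 1.1]. presearch: as the rank-one
sibling ([corpus: arXiv:1408.1733 Thm. 1.1/1.5] for the constant; no assembled partner road in print; corpus+galaxy).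
-/

-- D-0017: single-problem summit, so `Summit.BirchSwinnertonDyer.BirchSwinnertonDyer.…` repeats a namespace BY DESIGN.
set_option linter.dupNamespace false
set_option autoImplicit false

noncomputable section

open scoped Classical NumberField

open WeierstrassCurve NumberField IsDedekindDomain Literature Literature.NumberTheory.EllipticCurves
  Rat.HeightOneSpectrum CongruenceSubgroup
  Literature.NumberTheory.EllipticCurves.ModularForms
  Literature.NumberTheory.EllipticCurves.Rank1Residual
  Literature.NumberTheory.EllipticCurves.Rank1Residual.Typed
  Literature.NumberTheory.QuadraticFields.Quadratic
  Literature.NumberTheory.GaloisCohomology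
  Literature.NumberTheory.Automorphic
  Summit.BirchSwinnertonDyer.Rank1Residual
  Summit.BirchSwinnertonDyer.Rank1Residual.Additive
  Summit.BirchSwinnertonDyer.Rank1Residual.X11b
  Summit.BirchSwinnertonDyer.Rank1Residual.X11b.Three
  Summit.BirchSwinnertonDyer.BirchSwinnertonDyer.Theses.RamifiedHeegnerPair
  Summit.BirchSwinnertonDyer.BirchSwinnertonDyer.Theorems

namespace Summit.BirchSwinnertonDyer.BirchSwinnertonDyer.Theorems.LeafShimuraInert

/-! ## §U0.2 The U₀ core at one Jetchev–Skinner–Wan datum -/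

/-- **U₀ AT A LEAF CURVE FROM ONE FIELD DATUM, THE PARTNER'S RIBET–TAKAHASHI PACKAGE AND A PARTNER-SOURCED REAL DISPLAY.**
Data: the leaf curve `W` (`Addv W 3`, `SubGss W 3`, `r_an = 0`) with an `X₀(N)`-datum `Dt`, `3 ∤ c(Dt)`; a PARTNER `V` — globally
minimal, `3 ∤ N_V`, `V[3]` irreducible — with its optimal datum `D₀` (`IsNewformOf V D₀.f`, minimal degree, `3 ∤ c(D₀)`); an even set `S`
of primes multiplicative for BOTH curves with `ord_ℓ Δ_min(V) = ord_ℓ Δ_min(W)` on `S`, holding every Tamagawa-`3` carrier of `W` (SHAPE +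
très-ramifié clause off `S`); (G3) = the Pasten package with the cokernel-`3`-freeness property (body of `Partnerdescent.PartnerCokernelThreeFree`);
a field `K` (imaginary quadratic, `d_K` odd, `S` inert-unramified, every other bad prime of `W` split, `L(W^{d_K}, s)` with a SIMPLE zero at
`1`); AT `V`'s class-minimal Shimura datum of level `(∏S, N_V/∏S)` a point `P ∈ E(K)` and `degS ≥ 1` with `ord₃ degS = ord₃ deg P₀`, the
REAL display `degS·L′(E/K,1) = (2covol(Λ_E)·deg(D₀)/(c(D₀)²(w/2)²√|d_K|))·ĥ_K(P)` and the order clause `#Ш(E/K)[3^∞] ≤ 3^{2 ord₃[E(K):ℤP]}`;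
the rank-one twist's lower half. CONCLUSION: `Typed.MissingUpperBoundAt W 3`. CONDITIONAL; nothing booked; BSD is not proved.
[cite: CaiShuTian2014, Thm. 1.1 and Thm. 1.5] [cite: PastenShimura2024, Prop. 6.13, Lemmas 6.8, 6.14, §6.9]
[cite: PapikianRabinoff2016, Thm. 37 and the Remark following it] [cite: JetchevSkinnerWan2017, §7.4.1–7.4.2 and Thm. 4.4.1]
[cite: GrossZagier1986, V.§2] [cite: Miller2011LMS, Def. 1.1] -/
theorem leafRankZeroUpper_three_of_partnerDatum_at_pairing
    -- published inputs (named facts of the tree)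
    (hGZK : rank_eq_analyticRank_of_analyticRank_le_one) (hmod : hasEntireLFunction_rat)
    (hJL : nonempty_shimuraParametrizationData)
    -- (G3): the Pasten package WITH the cokernel `3`-freeness property (body of `Partnerdescent.PartnerCokernelThreeFree`)
    (hG3 : ∃ cI cJ : ComponentOrderFun,
      (∀ {D M : ℕ} {X : ShimuraCurveData D M} {W' : WeierstrassCurve ℚ}
          (P : ShimuraParametrizationData X W') (p : ℕ), 0 < cI P p ∧ 0 < cJ P p) ∧
      ComponentOrders.ProductEq cI cJ ∧ ComponentOrders.Prop613 cI cJ ∧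
      ComponentOrders.ImageEisenstein cI ∧ ComponentOrders.CokernelDvd cJ ∧
      (∀ {N D M : ℕ}, IsAdmissibleFactorization N D M →
        ∀ (X : ShimuraCurveData D M) (V : WeierstrassCurve ℚ) [V.IsElliptic] [V.IsGloballyMinimal],
          V.conductorNorm ℤ = N → ¬ 3 ∣ N → Irr V 3 →
        ∀ (V' : WeierstrassCurve ℚ) [V'.IsElliptic] (P : ShimuraParametrizationData X V'),
          P.IsMinimalFor V → ∀ p : ℕ, p.Prime → p ∣ D → ¬ 3 ∣ cJ P p))
    -- the leaf curve, with a datum whose constant is a `3`-unit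
    (W : WeierstrassCurve ℚ) [W.IsElliptic] [W.IsGloballyMinimal]
    (hadd : Addv W 3) (hsub : SubGss W 3) (hr : W.analyticRank = 0)
    {N : ℕ} [NeZero N] (hN : W.conductorNorm ℤ = N)
    (Dt : ModularParametrizationData W N) (hc : ¬ (3 : ℤ) ∣ Dt.c)
    -- the partner: globally minimal, `3 ∤ N_V`, `V[3]` irreducible, with its optimal datum `D₀` (`3 ∤ c`)
    (V : WeierstrassCurve ℚ) [V.IsElliptic] [V.IsGloballyMinimal]
    {NV : ℕ} [NeZero NV] (hNV : V.conductorNorm ℤ = NV) (h3NV : ¬ 3 ∣ NV)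
    (hirrV : V.HasIrreducibleModPGaloisRep 3)
    (V₀ : WeierstrassCurve ℚ) [V₀.IsElliptic] [V₀.IsGloballyMinimal] (D₀ : ModularParametrizationData V₀ NV)
    (hfV : IsNewformOf V D₀.f)
    (hminV : ∀ (V₂ : WeierstrassCurve ℚ) [V₂.IsElliptic] (D₂ : ModularParametrizationData V₂ NV),
      D₂.f = D₀.f → D₀.modularDegree ≤ D₂.modularDegree)
    (hcV : ¬ (3 : ℤ) ∣ D₀.c)
    -- the inert set: even, multiplicative for BOTH curves, same discriminant valuations, every carrier of `W` inside
    (S : Finset ℕ) (hSeven : Even S.card)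
    (hSmult : ∀ ℓ ∈ S, ∃ _ : Fact ℓ.Prime, W.HasMultiplicativeReductionAtPrime ℓ)
    (hSmultV : ∀ ℓ ∈ S, ∃ _ : Fact ℓ.Prime, V.HasMultiplicativeReductionAtPrime ℓ)
    (hΔS : ∀ ℓ ∈ S, padicValInt ℓ V.minimalDiscriminantInt = padicValInt ℓ W.minimalDiscriminantInt)
    (hFC : ∀ (ℓ : ℕ) [Fact ℓ.Prime], ℓ ∉ S → W.HasSplitMultiplicativeReductionAtPrime ℓ →
      ¬ 3 ∣ padicValInt ℓ W.minimalDiscriminantInt)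
    -- SHAPE: every Tamagawa-`3` carrier is split multiplicative
    (hshape : ∀ (q : ℕ) [Fact q.Prime], 3 ∣ (W.baseChange ℚ_[q]).localTamagawaNumber ℤ_[q] →
      W.HasSplitMultiplicativeReductionAtPrime q)
    -- ONE Jetchev–Skinner–Wan field datum, `d_K` odd
    (K : Type) [Field K] [NumberField K] (hK : IsImaginaryQuadratic K) (hodd : Odd (NumberField.discr K))
    (hinert : ∀ ℓ ∈ S, ((Ideal.span {(ℓ : ℤ)}).primesOver (𝓞 K)).ncard = 1 ∧ ¬ (ℓ : ℤ) ∣ NumberField.discr K)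
    (hsplitN : ∀ ℓ : ℕ, ℓ.Prime → ℓ ∣ W.conductorNorm ℤ → ℓ ∉ S →
      ((Ideal.span {(ℓ : ℤ)}).primesOver (𝓞 K)).ncard = 2)
    (hLt0 : (W.quadraticTwist (NumberField.discr K : ℚ)).entireLFunction 1 = 0)
    (hLt1 : deriv (W.quadraticTwist (NumberField.discr K : ℚ)).entireLFunction 1 ≠ 0)
    -- the PARTNER-sourced point, real display and order bound AT `V`'s class-minimal Shimura datum
    (hHKat : ∀ (X : ShimuraCurveData (∏ q ∈ S, q) (NV / ∏ q ∈ S, q)) (V' : WeierstrassCurve ℚ) [V'.IsElliptic]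
      (P₀ : ShimuraParametrizationData X V'), P₀.IsMinimalFor V →
      ∃ (P : (W.baseChange K).toAffine.Point) (degS : ℕ), 0 < degS ∧
        padicValNat 3 degS = padicValNat 3 P₀.deg ∧
        (degS : ℂ) * LDerivEK W K =
          ((2 * ZLattice.covolume Dt.L.lattice * (D₀.modularDegree : ℝ) /
              ((D₀.c : ℝ) ^ 2 * ((Units.torsionOrder K : ℝ) / 2) ^ 2 * √|(NumberField.discr K : ℝ)|) *
            P.canonicalHeight : ℝ) : ℂ) ∧
        (¬ IsOfFinAddOrder P →
          Nat.card (AddCommGroup.primaryComponent (W.baseChange K).sha 3) ≤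
            3 ^ (2 * padicValNat 3 (AddSubgroup.zmultiples P).index)))
    -- the partner's LOWER half at this field
    (hPL : ∀ (Wd : WeierstrassCurve ℚ) [Wd.IsElliptic] [Wd.IsGloballyMinimal] (Cd : VariableChange ℚ),
      Cd • W.quadraticTwist (NumberField.discr K : ℚ) = Wd → Typed.MissingLowerBoundAt Wd 3) :
    Typed.MissingUpperBoundAt W 3 := by
  subst hN
  subst hNV
  haveI h3F : Fact (Nat.Prime 3) := ⟨Nat.prime_three⟩
  have hNS : integral_neronScaling_of_isGloballyMinimal :=
    integral_neronScaling_of_isGloballyMinimal_holds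
  have hp : (3 : ℕ).Prime := Nat.prime_three
  have hp2 : (3 : ℕ) ≠ 2 := by decide
  have hirr : W.HasIrreducibleModPGaloisRep 3 := Additive.irr_of_subGss_of_ne_two W 3 hp2 hadd hsub
  have hbad3 : ¬ W.HasGoodReductionAtPrime 3 := not_good_of_addv W 3 hadd
  have hnm3 : ¬ W.HasMultiplicativeReductionAtPrime 3 := not_mult_of_addv W 3 hadd
  have hN0 : W.conductorNorm ℤ ≠ 0 := (W.conductorNorm_pos_holds).ne'
  haveI : NeZero (W.conductorNorm ℤ) := ⟨hN0⟩
  have hNpos : 0 < W.conductorNorm ℤ := W.conductorNorm_pos_holds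
  have hNV0 : V.conductorNorm ℤ ≠ 0 := (V.conductorNorm_pos_holds).ne'
  -- the set of multiplicative primes OF THE PARTNER and its Pasten package with (PG3)
  set Mlt : Finset ℕ := (V.conductorNorm ℤ).primeFactors.filter
    (fun q ↦ ∃ h : q.Prime, @WeierstrassCurve.HasMultiplicativeReductionAtPrime V q ⟨h⟩) with hMlt
  have hmemMlt : ∀ {q : ℕ} [hq : Fact q.Prime], V.HasMultiplicativeReductionAtPrime q → q ∈ Mlt := by
    intro q hq hm
    have hqN : q ∣ V.conductorNorm ℤ :=
      (V.dvd_conductorNorm_iff_not_hasGoodReductionAtPrime q).mpr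
        (WeierstrassCurve.HasMultiplicativeReduction.not_hasGoodReduction (R := ℤ_[q]) hm)
    exact Finset.mem_filter.mpr ⟨Nat.mem_primeFactors.mpr ⟨hq.out, hqN, hNV0⟩, hq.out, hm⟩
  obtain ⟨δ, cA, ι, κ, hδ0, hδ, hcA, hanchor, h613, hij, h68, hEis, -, hG3κ⟩ :=
    LeafPartnerRT.ribetTakahashiPackageCokerThree_of_componentOrdersFive hG3 PastenShimura2024_lemma_6_8_isogeny_holds hJL V 3
      hirrV (V.conductorNorm ℤ) V₀ D₀ rfl hfV hminV
  obtain ⟨hvA, hι⟩ := rtPackage_valuation_forms V 3 hirrV hcA h68 hEis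
  -- the inert set sits inside the partner's multiplicative primes and avoids `3`
  have hSMlt : S ⊆ Mlt := by
    intro ℓ hℓ
    obtain ⟨hℓF, hm⟩ := hSmultV ℓ hℓ
    exact @hmemMlt ℓ hℓF hm
  have hpS : 3 ∉ S := by
    intro h
    obtain ⟨_, hm⟩ := hSmult 3 h
    exact hnm3 hm
  -- (DEG) FOR THE PARTNER from (G3): every cokernel at a prime of an even level is `3`-free
  have hκ : ∀ ⦃D : Finset ℕ⦄, D ⊆ Mlt → Even D.card → ∀ ⦃r : ℕ⦄, r ∈ D → padicValNat 3 (κ D r) = 0 :=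
    fun D hD hDe r hrD ↦ padicValNat.eq_zero_of_not_dvd (hG3κ h3NV hirrV hD hDe hrD)
  have hdegV : padicValNat 3 (δ ∅) =
      padicValNat 3 (δ S) + ∑ x ∈ S, padicValNat 3 (padicValInt x V.minimalDiscriminantInt) :=
    LeafPartnerRT.padicValNat_delta_empty_eq_of_cokernelUnits h613 hδ hcA hij hvA hι hκ hSMlt hSeven
  have hdeg : padicValNat 3 (δ ∅) =
      padicValNat 3 (δ S) + ∑ x ∈ S, padicValNat 3 (padicValInt x W.minimalDiscriminantInt) := by
    rw [hdegV, Finset.sum_congr rfl fun x hx ↦ by rw [hΔS x hx]]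
  -- field data
  have h2 := hK.1
  have hd4 : NumberField.discr K % 4 = 1 := discr_emod_four_eq_one hK.1 hodd
  have h3N : 3 ∣ W.conductorNorm ℤ := (W.dvd_conductorNorm_iff_not_hasGoodReductionAtPrime 3).mpr hbad3
  have hps2 : ((Ideal.span {((3 : ℕ) : ℤ)}).primesOver (𝓞 K)).ncard = 2 := hsplitN 3 hp h3N hpS
  have hps : SplitsIn K 3 := hps2
  have hH3 : SatisfiesHeegnerHypothesis 3 K := fun q hq hq3 ↦ by
    have : q = 3 := (Nat.prime_dvd_prime_iff_eq hq hp).mp hq3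
    subst this; exact hps2
  have hpd : ¬ ((3 : ℕ) : ℤ) ∣ NumberField.discr K := not_dvd_discr_of_splitsIn h2 hp hps
  -- `d_K < -4` (odd, `≠ -3`), so `w_K = 2` is prime to `3`
  have hμ : ¬ 3 ∣ Units.torsionOrder K := by
    haveI : IsTotallyComplex K := hK.2
    have hneg : NumberField.discr K < 0 := discr_neg_of_finrank_eq_two K hK.1
    have h3d : NumberField.discr K ≠ -3 := by
      intro h; apply hpd; rw [h]; norm_num
    have h4 : NumberField.discr K < -4 := by omega
    rw [Literature.NumberTheory.DiophantineGeometry.torsionOrder_eq_two_of_discr_lt hK.1 h4]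
    decide
  have hSin : ∀ ℓ ∈ S, ∃ _ : Fact ℓ.Prime, Mult W ℓ ∧
      ((ℓ ≠ 2 ∧ jacobiSym (NumberField.discr K) ℓ = -1) ∨ (ℓ = 2 ∧ NumberField.discr K % 8 = 5)) := by
    intro ℓ hℓ
    obtain ⟨hℓF, hm⟩ := hSmult ℓ hℓ
    obtain ⟨hn, hd⟩ := hinert ℓ hℓ
    refine ⟨hℓF, hm, ?_⟩
    have hn' : ((Ideal.span {(ℓ : ℤ)}).primesOver (𝓞 K)).ncard ≠ 2 := by rw [hn]; decide
    by_cases hℓ2 : ℓ = 2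
    · subst hℓ2
      have hn2 : ((Ideal.span {(2 : ℤ)}).primesOver (𝓞 K)).ncard ≠ 2 := by
        simpa only [Nat.cast_ofNat] using hn'
      have hd2 : ¬ (2 : ℤ) ∣ NumberField.discr K := by simpa only [Nat.cast_ofNat] using hd
      exact Or.inr ⟨rfl, discr_emod_eight_eq_five_of_ncard_ne_two h2 hn2 hd2⟩
    · exact Or.inl ⟨hℓ2, jacobiSym_discr_eq_neg_one_of_ncard_ne_two h2 hℓF.out hℓ2 hn' hd⟩
  have hsplit : ∀ (ℓ : ℕ) [Fact ℓ.Prime], ¬ W.HasGoodReductionAtPrime ℓ → ℓ ∉ S →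
      IsSquare (algebraMap ℚ ℚ_[ℓ] (NumberField.discr K : ℚ)) := by
    intro ℓ hℓF hg hℓS
    have hℓN : ℓ ∣ W.conductorNorm ℤ := (W.dvd_conductorNorm_iff_not_hasGoodReductionAtPrime ℓ).mpr hg
    exact isSquare_discr_padic_of_ncard_eq_two h2 ℓ (hsplitN ℓ hℓF.out hℓN hℓS)
  -- `d_K` odd: the ramified primes of `K` are good primes `≥ 5` (`2 ∤ d_K`, `3 ∤ d_K`)
  have hdodd : ¬ (2 : ℤ) ∣ NumberField.discr K := by
    obtain ⟨k, hk⟩ := hodd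
    omega
  have h5 : ∀ (q : ℕ) [Fact q.Prime], (q : ℤ) ∣ NumberField.discr K → W.HasGoodReductionAtPrime q →
      5 ≤ q ∨ 5 ≤ 3 := by
    intro q hqF hqd _
    have hq : q.Prime := hqF.out
    have hq2 : q ≠ 2 := by
      rintro rfl
      exact hdodd (by exact_mod_cast hqd)
    have hq3 : q ≠ 3 := by
      rintro rfl
      exact hpd hqd
    exact Or.inl (hq.five_le_of_ne_two_of_ne_three hq2 hq3)
  -- a globally minimal model of the twist (a rank-ONE leaf curve), differing from the twisted equation by a `3`-unit
  have hD0 : (NumberField.discr K : ℚ) ≠ 0 := by exact_mod_cast NumberField.discr_ne_zero K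
  haveI hEt : (W.quadraticTwist (NumberField.discr K : ℚ)).IsElliptic :=
    W.isElliptic_quadraticTwist hD0
  obtain ⟨Cd, hCd⟩ := hasGlobalMinimalModel_rat_holds (W.quadraticTwist (NumberField.discr K : ℚ))
  haveI : (Cd • W.quadraticTwist (NumberField.discr K : ℚ)).IsGloballyMinimal := hCd
  set Wd : WeierstrassCurve ℚ := Cd • W.quadraticTwist (NumberField.discr K : ℚ) with hWd_def
  have hWd : Cd • W.quadraticTwist (NumberField.discr K : ℚ) = Wd := rfl
  have hu : padicValRat 3 (Cd.u : ℚ) = 0 :=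
    padicValRat_u_eq_zero_of_twist_minimal_of_splitsIn W 3 K h2 hps Cd hWd
  have hrt : (W.quadraticTwist (NumberField.discr K : ℚ)).analyticRank = 1 :=
    analyticRank_eq_one_of_entireLFunction_one_eq_zero_of_deriv_ne_zero _ (hmod _) hLt0 hLt1
  have hrd : Wd.analyticRank = 1 := by rw [← hWd, analyticRank_smul, hrt]
  -- the partner's lower half gives a RATIONAL `q_d = L′(Wd,1)/(Reg·Ω)` with `ord₃ q_d ≤ ord₃ #Ш(Wd) + ord₃ ∏c(Wd) − 2 ord₃ t_d`
  obtain ⟨q', hq', hq'le⟩ := hPL Wd Cd hWd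
  have hΩd : (Wd.realPeriodRat : ℂ) ≠ 0 := by exact_mod_cast Wd.realPeriodRat_pos_holds.ne'
  have hcd : (Wd.tamagawaProduct : ℂ) ≠ 0 := by exact_mod_cast Wd.tamagawaProduct_pos_holds.ne'
  have hRd : (Wd.regulator : ℂ) ≠ 0 := by exact_mod_cast Wd.regulator_pos'.ne'
  have htd0 : (Wd.torsionOrder : ℂ) ≠ 0 := by exact_mod_cast Wd.torsionOrder_pos_holds.ne'
  set qd : ℚ := q' * (Wd.tamagawaProduct : ℚ) / (Wd.torsionOrder : ℚ) ^ 2 with hqd_def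
  have hqd : Wd.leadingLCoeff = (((qd : ℝ) * Wd.regulator * Wd.realPeriodRat : ℝ) : ℂ) := by
    have h1 : Wd.leadingLCoeff = (q' : ℂ) * ((Wd.realPeriodRat : ℂ) * (Wd.tamagawaProduct : ℂ) *
        (Wd.regulator : ℂ)) / (Wd.torsionOrder : ℂ) ^ 2 := by
      rw [shaAn_def] at hq'
      field_simp at hq'
      field_simp
      linear_combination hq'
    rw [h1, hqd_def]
    push_cast
    field_simp
  ---------------------------------------------------------------- the Shimura curve `X_{N⁺,N⁻}`, `N⁻ = ∏ S`, and its class-minimal datum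
  obtain ⟨X, V', hV', P₀, hP₀, hdegδ⟩ := hanchor hSMlt hSeven
  haveI := hV'
  obtain ⟨P, degS, hdegS, hlinkS, hGZR, hUShP⟩ := hHKat X V' P₀ hP₀
  -- the two degree links (the partner's optimal degree IS `δ ∅`)
  have hlink₁ : padicValNat 3 D₀.modularDegree = padicValNat 3 (δ ∅) := by rw [hδ0]
  have hlink₂ : padicValNat 3 degS = padicValNat 3 (δ S) := by rw [hlinkS, hdegδ]
  ---------------------------------------------------------------- the `ρ`-Gross–Zagier identity, `ρ = deg(D₀)·c(Dt)²/(c(D₀)²·degS)`, `ord₃ ρ = Σ_S ord₃ ord_qΔ`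
  set ρ : ℚ := (D₀.modularDegree : ℚ) * (Dt.c : ℚ) ^ 2 / ((D₀.c : ℚ) ^ 2 * (degS : ℚ)) with hρ_def
  have hDtpos : 0 < D₀.modularDegree := D₀.deg_pos
  have hcM0 : (Dt.c : ℚ) ≠ 0 := by
    have : Dt.c ≠ 0 := by rintro h0; exact hc (h0 ▸ dvd_zero (3 : ℤ))
    exact_mod_cast this
  have hcV0 : (D₀.c : ℚ) ≠ 0 := by
    have : D₀.c ≠ 0 := by rintro h0; exact hcV (h0 ▸ dvd_zero (3 : ℤ))
    exact_mod_cast this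
  have hρ0 : 0 < ρ := by
    rw [hρ_def]
    refine div_pos (mul_pos (by exact_mod_cast hDtpos) ?_) (mul_pos ?_ (by exact_mod_cast hdegS))
    · exact lt_of_le_of_ne (sq_nonneg _) (Ne.symm (pow_ne_zero 2 hcM0))
    · exact lt_of_le_of_ne (sq_nonneg _) (Ne.symm (pow_ne_zero 2 hcV0))
  have hρ : padicValRat 3 ρ = (∑ x ∈ S, padicValNat 3 (padicValInt x W.minimalDiscriminantInt) : ℕ) := by
    have hvc : padicValRat 3 (Dt.c : ℚ) = 0 := by
      rw [padicValRat.of_int, padicValInt.eq_zero_of_not_dvd hc]; rfl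
    have hvcV : padicValRat 3 (D₀.c : ℚ) = 0 := by
      rw [padicValRat.of_int, padicValInt.eq_zero_of_not_dvd hcV]; rfl
    rw [hρ_def, padicValRat.div (mul_ne_zero (by exact_mod_cast hDtpos.ne') (pow_ne_zero 2 hcM0))
        (mul_ne_zero (pow_ne_zero 2 hcV0) (by exact_mod_cast hdegS.ne')),
      padicValRat.mul (by exact_mod_cast hDtpos.ne') (pow_ne_zero 2 hcM0),
      padicValRat.mul (pow_ne_zero 2 hcV0) (by exact_mod_cast hdegS.ne'),
      padicValRat.pow, padicValRat.pow, hvc, hvcV, padicValRat.of_nat, padicValRat.of_nat, hlink₁, hlink₂, hdeg]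
    push_cast
    ring
  have hLD : LDerivEK W K = (((ρ : ℝ) * grossZagierConstant Dt K * P.canonicalHeight : ℝ) : ℂ) := by
    have hdegS0 : (degS : ℂ) ≠ 0 := by exact_mod_cast hdegS.ne'
    have hcZ : Dt.c ≠ 0 := by rintro h0; exact hc (h0 ▸ dvd_zero (3 : ℤ))
    have hcVZ : D₀.c ≠ 0 := by rintro h0; exact hcV (h0 ▸ dvd_zero (3 : ℤ))
    have hcMC : (Dt.c : ℂ) ≠ 0 := by exact_mod_cast hcZ
    have hcVC : (D₀.c : ℂ) ≠ 0 := by exact_mod_cast hcVZ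
    have key : LDerivEK W K = ((2 * ZLattice.covolume Dt.L.lattice * (D₀.modularDegree : ℝ) /
          ((D₀.c : ℝ) ^ 2 * ((Units.torsionOrder K : ℝ) / 2) ^ 2 * √|(NumberField.discr K : ℝ)|) *
        P.canonicalHeight : ℝ) : ℂ) / (degS : ℂ) := by
      rw [← hGZR, mul_div_cancel_left₀ _ hdegS0]
    rw [key, hρ_def]
    unfold grossZagierConstant
    push_cast
    field_simp
  ---------------------------------------------------------------- the rank-zero bookkeeping (bsd-print-x6, rational factor of any valuation)
  obtain ⟨hfinW, hfinSd, -, hPinf, q, hshaAn, hval⟩ :=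
    exists_shaAn_padicVal_eq_of_gzIdentity_rankZero_ratFactorVal W 3 (W.conductorNorm ℤ) K Dt P hGZK hmod hK hp2 hc hμ hr
      Wd Cd hWd hu hrd qd hqd ρ hρ0 hLD
  have hUSh := hUShP hPinf
  ---------------------------------------------------------------- `Ш(E/K)[3^∞] = Ш(E)[3^∞] ⊕ Ш(E^d)[3^∞]`
  haveI : (W.baseChange K).IsElliptic := inferInstanceAs (W.map (algebraMap ℚ K)).IsElliptic
  haveI : Finite W.sha := hfinW
  haveI : Finite Wd.sha := hfinSd
  haveI : Finite (AddCommGroup.primaryComponent W.sha 3) := Finite.of_injective _ Subtype.val_injective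
  haveI : Finite (AddCommGroup.primaryComponent Wd.sha 3) := Finite.of_injective _ Subtype.val_injective
  have hprod := card_primaryComponent_sha_baseChange_quadratic_of_odd_of_finite W K h2 Wd ⟨Cd, hWd⟩
    (W.baseChange K) ⟨1, one_smul _ _⟩ 3 hp2
  rw [card_addPrimaryComponent_eq_pow (A := ↥W.sha) 3, card_addPrimaryComponent_eq_pow (A := ↥Wd.sha) 3,
    ← pow_add, Nat.factorization_def _ hp, Nat.factorization_def _ hp] at hprod
  rw [hprod] at hUSh
  have e1 : padicValNat 3 (Nat.card W.sha) + padicValNat 3 (Nat.card Wd.sha) ≤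
      2 * padicValNat 3 (AddSubgroup.zmultiples P).index :=
    (Nat.pow_le_pow_iff_right hp.one_lt).mp hUSh
  ---------------------------------------------------------------- the numeric Tamagawa condition, the partner's lower half, conclusion
  have hT := padicValNat_tamagawaProduct_add_twist_le_of_inertSet'_odd W 3 hp2 K h2 hdodd h5 hshape Cd hWd S
    hSin (fun ℓ _ hg hℓS ↦ hsplit ℓ hg hℓS) (fun ℓ _ hℓS hs ↦ hFC ℓ hℓS hs)
  have hq'0 : q' ≠ 0 := by
    intro h0
    apply Wd.leadingLCoeff_ne_zero_holds (hmod Wd)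
    rw [hqd, hqd_def, h0]
    simp
  have hvqd : padicValRat 3 qd = padicValRat 3 q' + padicValNat 3 Wd.tamagawaProduct -
      2 * padicValNat 3 Wd.torsionOrder := by
    have ht' : (Wd.torsionOrder : ℚ) ≠ 0 := by exact_mod_cast Wd.torsionOrder_pos_holds.ne'
    have hc' : (Wd.tamagawaProduct : ℚ) ≠ 0 := by exact_mod_cast Wd.tamagawaProduct_pos_holds.ne'
    rw [hqd_def, padicValRat.div (mul_ne_zero hq'0 hc') (pow_ne_zero 2 ht'), padicValRat.mul hq'0 hc',
      padicValRat.pow, padicValRat.of_nat, padicValRat.of_nat]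
    ring
  refine ⟨q, hshaAn, ?_⟩
  have e1' : (padicValNat 3 W.shaOrder : ℤ) + padicValNat 3 Wd.shaOrder ≤
      2 * padicValNat 3 (AddSubgroup.zmultiples P).index := by
    unfold WeierstrassCurve.shaOrder; exact_mod_cast e1
  have e4 : (padicValNat 3 W.tamagawaProduct : ℤ) + padicValNat 3 Wd.tamagawaProduct ≤
      (∑ x ∈ S, padicValNat 3 (padicValInt x W.minimalDiscriminantInt) : ℕ) := by exact_mod_cast hT
  have e5 : padicValRat 3 q' ≤ (padicValNat 3 Wd.shaOrder : ℤ) := hq'le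
  rw [hρ, hvqd] at hval
  omega

end Summit.BirchSwinnertonDyer.BirchSwinnertonDyer.Theorems.LeafShimuraInert

end
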